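import Literature.NumberTheory.LFunctions.EquivalentsJensenProofs
import Literature.NumberTheory.LFunctions.RiemannHypothesisUpTo101
import Literature.NumberTheory.LFunctions.RiemannHypothesisUpTo2516
import HarnessLib

/-!
# Certified ALL-SHIFT hyperbolicity ranges for the Jensen polynomials of `ξ`:
# `d ≤ 2 550 → 10 201` (kernel) and `d ≤ 1 582 564 → 6 330 256` (compiled), every shift `n`;
# the printed reduction `RH(T) ∧ d ≤ T² ⇒ ∀ n` (GORTTW Thm. 1.2 / Kim–Lee Thm. 4)

The Jensen polynomials `J^{d,n}_γ(X) = Σ_{j ≤ d} (d choose j) γ(n+j) X^j` of the Taylor coefficients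
`γ = xiTaylorCoeff` of `(-1 + 4z²) Λ(½ + z)` (`RiemannXi.lean`) are hyperbolic for ALL `d, n` iff RH
(Pólya 1927; the tree's `polya_jensen_holds`).  The printed all-shift ranges are corollaries of a
verified RH height `T`: `RH_m(T) ∧ d ≤ ⌊T⌋² ⇒ J^{d,n}_γ` hyperbolic for all `n ≥ m`
(Griffin–Ono–Rolen–Thorner–Tripp–Wagner, Adv. Math. 397 (2022), Thm. 1.2 — `d ≤ 9.36·10²⁰` from
Platt's height in arXiv v3 Cor. 1.3, `d ≤ 9·10²⁴` from Platt–Trudgian's `T = 3 000 175 332 800` in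
the journal version and in Kim–Lee, J. Korean Math. Soc. 59 (2022), Thm. 4 and Remark; earlier
`d ≤ 2·10¹⁷` for all shifts in Chasse's thesis (2011), Thm. 177, from the 1986 height
`545 439 823`).  In the tree the mechanism is the theorem
`jensenPoly_xiTaylorCoeff_splits_of_riemannHypothesisUpTo` (`EquivalentsJensenProofs.lean`:
`1 ≤ T`, `RiemannHypothesisUpTo T`, `4d ≤ T²` ⇒ `J^{d,n}_γ` splits over `ℝ` for every `n`; the
cruder constant `4d ≤ T²` replaces the printed `d ≤ ⌊T⌋²`), used there only with the
kernel-certified height `T = 16` (`jensenPoly_xiTaylorCoeff_splits_of_le`: `d ≤ 64`, all `n`).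

This file threads the tree's two larger RH-height certificates through the same theorem:

* `jensenPoly_xiTaylorCoeff_splits_allShifts_of_le_2550` — `J^{d,n}_γ` hyperbolic for every `n` and
  every `d ≤ 2 550` (`4 · 2 550 = 10 200 ≤ 101²`), from `riemannHypothesisUpTo_hundredOne`
  (`RiemannHypothesisUpTo101.lean`, Backlund-type certificate, `decide +kernel`): **standard axioms
  only** — the kernel-grade all-shift range grows from `d ≤ 64` to `d ≤ 2 550`;
* `jensenPoly_xiTaylorCoeff_splits_allShifts_of_le_1582564` — hyperbolic for every `n` and every
  `d ≤ 1 582 564` (`4 · 1 582 564 = 6 330 256 = 2516²`), from `riemannHypothesisUpTo_2516`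
  (`RiemannHypothesisUpTo2516.lean`, the `2000` zeros of the certified Odlyzko–te Riele computation):
  standard axioms plus the `native_decide` auxiliary axioms of that certificate (proposal flag
  `computational`), exactly as for the shift-`0` range `d ≤ 6 330 256` of
  `Literature/Barriers/RiemannHypothesis/JensenPolynomialsChasseProofs.lean`.

What is NOT here: nothing about zeros follows from such ranges (no converse — the barrier
`Literature.Barriers.RiemannHypothesis.JensenPolynomialsShiftUniform_holds` exhibits, for every
degree bound `D`, a function with all `J^{d,n}`, `d ≤ D`, hyperbolic and a non-real zero); the
printed range `d ≤ 9·10²⁴` stays conditional on the named fact `platt_trudgian_numerical_rh`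
(`GORZ2019_chasse_of_platt_trudgian_numerical_rh`, shift `0`; here, for all shifts,
`jensenPoly_xiTaylorCoeff_splits_allShifts_of_platt_trudgian`).

## The printed constant `d ≤ T²` (second part of the file)

The last section removes the factor `4`: with the cone slope `κ_T = 4T/(4T² - 1)` (instead of
`2/T`) and the sharp cone-to-sector comparison `K_κ ⊆ S(κ/√(1+κ²))` (instead of `S(κ)`) the same
argument gives `RiemannHypothesisUpTo T ∧ d ≤ T² ⇒ J^{d,n}_γ` hyperbolic for every `n`
(`jensenPoly_xiTaylorCoeff_splits_allShifts_of_riemannHypothesisUpTo`) — GORTTW's Thm. 1.2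
(`d ≤ ⌊T⌋²`, case `m = 0`) and Kim–Lee's Thm. 4 (`d ≤ T²(1 + 4⁻¹T⁻²)²`, of which `d ≤ T²` is the
integer content) with the printed constant. Hence ALL shifts for `d ≤ 10 201 = 101²` (kernel) and
`d ≤ 6 330 256 = 2516²` (compiled) — the same ranges as the shift-`0` theorems of
`JensenPolynomialsChasseProofs.lean` — and, conditionally on the Platt–Trudgian named hypothesis,
the printed `d ≤ 9·10²⁴` for every `n`.

## References

* [KimLee2021] Y.-O. Kim, J. Lee, *A note on the zeros of Jensen polynomials*, J. Korean Math.
  Soc. 59 (2022) 775–787 = arXiv:2105.05386, Thm. 4 and Remark.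
* [GriffinEtAl2022] M. Griffin, K. Ono, L. Rolen, J. Thorner, Z. Tripp, I. Wagner, Adv. Math. 397
  (2022) 108186, Thm. 1.2 and Cor. 1.3.
* [PlattTrudgianBLMS2021] D. J. Platt, T. S. Trudgian, Bull. Lond. Math. Soc. 53 (2021) 792–797,
  Thm. 1.
* [Chasse2013] M. Chasse, Complex Var. Elliptic Equ. 58 (2013) 875–885, Thm. 1.8 (thesis U. Hawaii
  2011, Thm. 177).
* [OdlyzkoTeRiele1985] A. M. Odlyzko, H. J. J. te Riele, J. reine angew. Math. 357 (1985), §4.2.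
* [Edwards1974] H. M. Edwards, *Riemann's Zeta Function*, §6.6.
-/

noncomputable section

open Polynomial

namespace Literature.NumberTheory.LFunctions

open Literature.NumberTheory.DiophantineGeometry

/-- **`J^{d,n}_γ` is hyperbolic for every shift `n` and every degree `d ≤ 2 550`, kernel-certified**
(standard axioms only): Kim–Lee's / GORTTW's reduction "RH up to height `T` and `4d ≤ T²` ⇒
`J^{d,n}_γ` splits for all `n`" (`jensenPoly_xiTaylorCoeff_splits_of_riemannHypothesisUpTo`) applied
to the tree's kernel verification of RH up to height `101` (`riemannHypothesisUpTo_hundredOne`,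
`N(101) = 29`); `4 · 2 550 = 10 200 ≤ 10 201 = 101²`.
[cite: KimLee2021, Theorem 4 and Remark] [cite: GriffinEtAl2022, Theorem 1.2] [cite: Edwards1974, §6.6] -/
theorem jensenPoly_xiTaylorCoeff_splits_allShifts_of_le_2550 {d : ℕ} (hd : d ≤ 2550) (n : ℕ) :
    (jensenPoly xiTaylorCoeff d n).Splits := by
  refine jensenPoly_xiTaylorCoeff_splits_of_riemannHypothesisUpTo (T := 101) (by norm_num)
    riemannHypothesisUpTo_hundredOne ?_ n
  have h : (d : ℝ) ≤ 2550 := by exact_mod_cast hd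
  norm_num
  linarith

/-- **`J^{d,n}_γ` is hyperbolic for every shift `n` and every degree `d ≤ 1 582 564`, certified by
compiled evaluation**: the same reduction applied to RH up to height `2516`
(`riemannHypothesisUpTo_2516`: the `2000` zeros of the tree's certified Odlyzko–te Riele computation;
depends on the `native_decide` auxiliary axioms of that certificate); `4 · 1 582 564 = 6 330 256 = 2516²`.
This is the all-shift companion of the shift-`0` range `d ≤ 6 330 256` of
`Literature.Barriers.RiemannHypothesis.jensenPoly_xiTaylorCoeff_splits_of_le_6330256`.
[cite: KimLee2021, Theorem 4 and Remark] [cite: GriffinEtAl2022, Theorem 1.2] [cite: OdlyzkoTeRiele1985, §4.2 p. 151] -/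
theorem jensenPoly_xiTaylorCoeff_splits_allShifts_of_le_1582564 {d : ℕ} (hd : d ≤ 1582564) (n : ℕ) :
    (jensenPoly xiTaylorCoeff d n).Splits := by
  refine jensenPoly_xiTaylorCoeff_splits_of_riemannHypothesisUpTo (T := 2516) (by norm_num)
    riemannHypothesisUpTo_2516 ?_ n
  have h : (d : ℝ) ≤ 1582564 := by exact_mod_cast hd
  norm_num
  linarith

/-- The two certified all-shift ranges as one statement in GORZ's wording ("`J^{d,n}_γ` is hyperbolic
for every `n ≥ 0`", here for all `1 ≤ d ≤ 1 582 564`; compiled evaluation — `d ≤ 2 550` in the kernel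
alone), extending the tree's `gorz_le_eight_holds` (`d ≤ 8`) and `jensenPoly_xiTaylorCoeff_splits_of_le`
(`d ≤ 64`). [cite: KimLee2021, Theorem 4 and Remark] -/
theorem jensenPoly_xiTaylorCoeff_splits_allShifts_upTo_1582564 :
    ∀ d n : ℕ, d ≤ 1582564 → (jensenPoly xiTaylorCoeff d n).Splits :=
  fun _ n hd => jensenPoly_xiTaylorCoeff_splits_allShifts_of_le_1582564 hd n

/-! ## The printed constant: RH up to height `T` gives ALL shifts for `d ≤ T²`

The reduction `jensenPoly_xiTaylorCoeff_splits_of_riemannHypothesisUpTo` (`EquivalentsJensenProofs.lean`)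
loses a factor `4` (`4d ≤ T²`) in two places: it puts the zeros of `G` in the cone `K_{2/T}` (slope
`2/T`, where `4T/(4T² - 1) ≈ 1/T` suffices) and it compares the cone `K_κ` with the sector `S(κ)`
(where `S(κ/√(1+κ²))` suffices). Repairing both gives Kim–Lee's printed range: with
`κ_T = 4T/(4T² - 1)` and `δ_T = 4T/(4T² + 1)` one has `κ_T² = δ_T²(1 + κ_T²)`, so
`K_{κ_T} ⊆ S(δ_T)`, and `δ_T⁻² = (4T² + 1)²/(16T²) = T²(1 + 4⁻¹T⁻²)² ≥ T²`. -/

open Literature.Analysis.Complex.Obreschkoff Literature.Analysis.TotalPositivity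

/-- **Cone-to-sector comparison, sharp form.** For `κ, δ ≥ 0` with `κ² ≤ δ²(1 + κ²)` (equality for
`δ = κ/√(1+κ²) = sin(arctan κ)`), the closed cone `K_κ = {|Im z| ≤ -κ Re z}` lies in Kim–Lee's
double sector `S(δ) = {|Im z| ≤ δ|z|}`: from `|Im z| ≤ -κ Re z` one gets `Im² z ≤ κ² Re² z`, hence
`(1 + κ²) Im² z ≤ κ²|z|² ≤ δ²(1 + κ²)|z|²` (so `κ ≥ 0` is not even needed; the tree's
`negCone_subset_sector` is the case `δ = κ`). Private plumbing for the next two theorems.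
[folklore] -/
private theorem negCone_subset_sector_of_sq_le {κ δ : ℝ} (hδ : 0 ≤ δ)
    (h : κ ^ 2 ≤ δ ^ 2 * (1 + κ ^ 2)) :
    {z : ℂ | z.im + κ * z.re ≤ 0 ∧ -z.im + κ * z.re ≤ 0} ⊆ sector δ := by
  rintro z ⟨h1, h2⟩
  rw [mem_sector]
  have habs : |z.im| ≤ κ * (-z.re) := by
    rw [abs_le]; constructor <;> linarith
  have hm : z.im * z.im ≤ κ * (-z.re) * (κ * (-z.re)) := by
    have h' := mul_self_le_mul_self (abs_nonneg z.im) habs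
    rwa [abs_mul_abs_self] at h'
  have him2 : z.im ^ 2 ≤ κ ^ 2 * z.re ^ 2 := by nlinarith [hm]
  have hS : 0 ≤ z.re ^ 2 + z.im ^ 2 := by positivity
  have h3 : (1 + κ ^ 2) * z.im ^ 2 ≤ (1 + κ ^ 2) * (δ ^ 2 * (z.re ^ 2 + z.im ^ 2)) := by
    nlinarith [him2, mul_le_mul_of_nonneg_right h hS]
  have h4 : z.im ^ 2 ≤ δ ^ 2 * (z.re ^ 2 + z.im ^ 2) :=
    le_of_mul_le_mul_left h3 (by positivity)
  have hnorm : ‖z‖ ^ 2 = z.re ^ 2 + z.im ^ 2 := by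
    rw [Complex.sq_norm, Complex.normSq_apply]; ring
  have hsq : z.im ^ 2 ≤ (δ * ‖z‖) ^ 2 := by
    rw [mul_pow, hnorm]; exact h4
  have h5 := sq_le_sq.1 hsq
  rwa [abs_of_nonneg (by positivity : (0 : ℝ) ≤ δ * ‖z‖)] at h5

/-- **The zeros of `G` under RH up to height `T`, with the sharp slope** (Kim–Lee 2021, proof of
Thm. 4, "`Z(f₀) ⊂ S̃`", keeping the printed constant). If every zero of `ζ` with `0 < Im ρ ≤ T` has
`Re ρ = ½` (`T ≥ 1`) and `κ ≥ 0` satisfies `κ(T² - ¼) ≥ T` (e.g. `κ = 4T/(4T² - 1)`), then every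
zero `w = (ρ - ½)²` of `G` (`G(w) = ξ(½ + √w)`, `Literature.NumberTheory.LFunctions.xiSq`) lies in
the cone `K_κ = {|Im w| ≤ -κ Re w}`. Writing `x = Re ρ - ½`, `y = Im ρ` (`Re w = x² - y²`,
`Im w = 2xy`, `|x| ≤ ½`): if `|y| ≤ T` then `x = 0`; if `|y| > T` then
`|2xy| ≤ |y| ≤ κ(y² - ¼) ≤ κ(y² - x²)`, the middle step because
`κ(y² - ¼) - |y| - (κ(T² - ¼) - T) = (|y| - T)(κ(|y| + T) - 1) ≥ 0` (`κT ≥ 1`).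
[cite: KimLee2021, Theorem 4 (proof) and Remark] -/
theorem xiSq_zeros_mem_negCone_of_le {T κ : ℝ} (hT : 1 ≤ T) (hκ : 0 ≤ κ)
    (hκT : T ≤ κ * (T ^ 2 - 1 / 4)) (hRH : RiemannHypothesisUpTo T) {w : ℂ} (hw : xiSq w = 0) :
    w ∈ {z : ℂ | z.im + κ * z.re ≤ 0 ∧ -z.im + κ * z.re ≤ 0} := by
  rw [xiSq_eq] at hw
  obtain ⟨hζ, h0, h1⟩ := (riemannXi_eq_zero_iff_holds _).1 hw
  set ρ : ℂ := 1 / 2 + w ^ (2⁻¹ : ℂ) with hρ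
  have hwρ : (ρ - 1 / 2) ^ 2 = w := by
    rw [hρ, add_sub_cancel_left]
    exact_mod_cast Complex.cpow_nat_inv_pow w two_ne_zero
  set x : ℝ := ρ.re - 1 / 2 with hx
  set y : ℝ := ρ.im with hy
  have hre : w.re = x ^ 2 - y ^ 2 := by
    rw [← hwρ, hx, hy]; simp [sq]
  have him : w.im = 2 * x * y := by
    rw [← hwρ, hx, hy]; simp [sq]; ring
  have hxabs : |x| ≤ 1 / 2 := by
    rw [abs_le, hx]; constructor <;> linarith
  have hT0 : 0 < T := by linarith
  -- `κ T ≥ 1`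
  have hκT1 : 1 ≤ κ * T := by
    have h' : 1 * T ≤ κ * T * T := by nlinarith
    exact le_of_mul_le_mul_right h' hT0
  -- the key inequality `|2xy| ≤ κ (y² - x²)`
  have key : |2 * x * y| ≤ κ * (y ^ 2 - x ^ 2) := by
    by_cases hyT : |y| ≤ T
    · -- RH up to height `T`: the zero is on the critical line
      have hxz : x = 0 := by
        rcases lt_trichotomy y 0 with hneg | hzero | hpos
        · have := hRH.re_eq_of_im_neg hζ hneg (by rw [hy] at hyT; exact (neg_le_abs _).trans hyT)
          rw [hx, this, sub_self]
        · exact absurd hζ (riemannZeta_ne_zero_of_im_eq_zero_of_pos_of_lt_one hzero h0 h1)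
        · have := hRH ρ hζ hpos ((le_abs_self _).trans hyT)
          rw [hx, this, sub_self]
      rw [hxz]
      simp only [mul_zero, zero_mul, abs_zero]
      nlinarith [sq_nonneg y]
    · rw [not_le] at hyT
      have hxsq : x ^ 2 ≤ 1 / 4 := by
        rw [← sq_abs]; nlinarith [abs_nonneg x]
      -- `|2xy| ≤ |y|`
      have hA : |2 * x * y| ≤ |y| := by
        rw [abs_mul, abs_mul, abs_two]
        nlinarith [mul_nonneg (sub_nonneg.2 hxabs) (abs_nonneg y)]
      -- `|y| ≤ κ (y² - 1/4)`
      have hB : |y| ≤ κ * (y ^ 2 - 1 / 4) := by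
        have hyT' : 0 ≤ |y| - T := by linarith
        have hC' : 0 ≤ κ * (|y| + T) - 1 := by nlinarith [abs_nonneg y]
        have hprod := mul_nonneg hyT' hC'
        have hysqκ : κ * |y| ^ 2 = κ * y ^ 2 := by rw [sq_abs]
        nlinarith [hprod, hκT, hysqκ]
      -- `κ (y² - 1/4) ≤ κ (y² - x²)`
      have hC : κ * (y ^ 2 - 1 / 4) ≤ κ * (y ^ 2 - x ^ 2) :=
        mul_le_mul_of_nonneg_left (by linarith) hκ
      linarith
  have hk3 : 2 * x * y ≤ |2 * x * y| := le_abs_self _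
  have hk4 : -(2 * x * y) ≤ |2 * x * y| := neg_le_abs _
  simp only [Set.mem_setOf_eq, hre, him]
  constructor <;> nlinarith

/-- **RH up to height `T` makes `J^{d,n}_γ` hyperbolic for every `d ≤ T²` and every shift `n`** —
the printed constant of Griffin–Ono–Rolen–Thorner–Tripp–Wagner, Thm. 1.2 ("If `RH_m(T)` is true and
`d ≤ ⌊T⌋²`, then `J^{d,n}(X)` is hyperbolic for all `n ≥ m`"; case `m = 0`) and of Kim–Lee, Thm. 4
and Remark ("`J(f₀⁽ⁿ⁾; d)` is hyperbolic for `d ≤ T²(1 + 4⁻¹T⁻²)²` and for every `n`"; `d ≤ T²` is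
its integer content): `splits_jensenPoly_taylor_of_zeros_mem_convex` for `G = xiSq` (order
`≤ 7/8 < 1`, real, `G(0) ≠ 0`) with the convex cone `K_κ`, `κ = 4T/(4T² - 1)`
(`xiSq_zeros_mem_negCone_of_le`, `κ(T² - ¼) = T`), inside the sector `S(δ)`, `δ = 4T/(4T² + 1)`
(`negCone_subset_sector_of_sq_le`, `κ² = δ²(1 + κ²)`), and `d δ² ≤ 1 ⇔ 16T²d ≤ (4T² + 1)²`, implied
by `d ≤ T²`; finally `γ(k) = 8 Re G⁽ᵏ⁾(0)`. Supersedes the range `4d ≤ T²` of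
`jensenPoly_xiTaylorCoeff_splits_of_riemannHypothesisUpTo`.
[cite: GriffinEtAl2022, Theorem 1.2] [cite: KimLee2021, Theorem 4 and Remark] -/
theorem jensenPoly_xiTaylorCoeff_splits_allShifts_of_riemannHypothesisUpTo {T : ℝ} (hT : 1 ≤ T)
    (hRH : RiemannHypothesisUpTo T) {d : ℕ} (hd : (d : ℝ) ≤ T ^ 2) (n : ℕ) :
    (jensenPoly xiTaylorCoeff d n).Splits := by
  obtain ⟨C₀, hC₀⟩ := norm_xiSq_le
  have hF : IsEntireOfOrderLtOne xiSq := ⟨differentiable_xiSq, 7 / 8, C₀, by norm_num, hC₀⟩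
  have hT0 : 0 < T := by linarith
  have h4T : 0 < 4 * T ^ 2 - 1 := by nlinarith
  have h4T' : 4 * T ^ 2 - 1 ≠ 0 := h4T.ne'
  have h4T1 : 4 * T ^ 2 + 1 ≠ 0 := by positivity
  have hκ : (0 : ℝ) ≤ 4 * T / (4 * T ^ 2 - 1) := div_nonneg (by linarith) h4T.le
  have hδ : (0 : ℝ) ≤ 4 * T / (4 * T ^ 2 + 1) := div_nonneg (by linarith) (by positivity)
  have hκT : T ≤ 4 * T / (4 * T ^ 2 - 1) * (T ^ 2 - 1 / 4) := by
    rw [div_mul_eq_mul_div, le_div_iff₀ h4T]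
    apply le_of_eq
    ring
  have hκδ : (4 * T / (4 * T ^ 2 - 1)) ^ 2 ≤
      (4 * T / (4 * T ^ 2 + 1)) ^ 2 * (1 + (4 * T / (4 * T ^ 2 - 1)) ^ 2) := by
    apply le_of_eq
    field_simp
    ring
  have hdδ : (d : ℝ) * (4 * T / (4 * T ^ 2 + 1)) ^ 2 ≤ 1 := by
    rw [div_pow, ← mul_div_assoc, div_le_one (by positivity)]
    have h16 : 16 * T ^ 2 * (d : ℝ) ≤ 16 * T ^ 2 * T ^ 2 :=
      mul_le_mul_of_nonneg_left hd (by positivity)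
    nlinarith [h16]
  have h := splits_jensenPoly_taylor_of_zeros_mem_convex hF xiSq_conj xiSq_zero_ne
    (convex_negCone (4 * T / (4 * T ^ 2 - 1))) (negCone_subset_sector_of_sq_le hδ hκδ)
    (fun z hz => xiSq_zeros_mem_negCone_of_le hT hκ hκT hRH hz) hdδ n
  -- the Taylor coefficients of `G` at `0` are `γ(k)/8` (`re_iteratedDeriv_xiSq_div`)
  have hcoef : (fun k => (iteratedDeriv k xiSq 0).re) = fun k => 8⁻¹ * xiTaylorCoeff k := by
    funext k
    have h1 := re_iteratedDeriv_xiSq_div k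
    have hk : (Nat.factorial k : ℝ) ≠ 0 := by positivity
    rwa [← mul_div_assoc, div_left_inj' hk] at h1
  rw [hcoef, Literature.Analysis.Complex.PolyaSchur.jensenPoly_const_mul] at h
  have h8 : jensenPoly xiTaylorCoeff d n =
      Polynomial.C (8 : ℝ) * (Polynomial.C (8⁻¹ : ℝ) * jensenPoly xiTaylorCoeff d n) := by
    rw [← mul_assoc, ← C_mul, mul_inv_cancel₀ (by norm_num : (8 : ℝ) ≠ 0), C_1, one_mul]
  rw [h8]
  exact h.C_mul 8

/-- **`J^{d,n}_γ` is hyperbolic for every shift `n` and every degree `d ≤ 10 201 = 101²`,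
kernel-certified** (standard axioms only), from `riemannHypothesisUpTo_hundredOne` (`N(101) = 29`,
`decide +kernel`) and the printed constant `d ≤ T²`: the all-shift companion of the shift-`0`
theorem `Literature.Barriers.RiemannHypothesis.jensenPoly_xiTaylorCoeff_splits_of_le_10201`, and
`4×` the range of `jensenPoly_xiTaylorCoeff_splits_allShifts_of_le_2550`.
[cite: GriffinEtAl2022, Theorem 1.2] [cite: KimLee2021, Theorem 4 and Remark] [cite: Edwards1974, §6.6] -/
theorem jensenPoly_xiTaylorCoeff_splits_allShifts_of_le_10201 {d : ℕ} (hd : d ≤ 10201) (n : ℕ) :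
    (jensenPoly xiTaylorCoeff d n).Splits :=
  jensenPoly_xiTaylorCoeff_splits_allShifts_of_riemannHypothesisUpTo (T := 101) (by norm_num)
    riemannHypothesisUpTo_hundredOne (by norm_num; exact_mod_cast hd) n

/-- **`J^{d,n}_γ` is hyperbolic for every shift `n` and every degree `d ≤ 6 330 256 = 2516²`,
certified by compiled evaluation**, from `riemannHypothesisUpTo_2516` (the `2000` zeros of the tree's
certified Odlyzko–te Riele computation; depends on the `native_decide` auxiliary axioms of that
certificate) and the printed constant `d ≤ T²`: the all-shift companion of
`Literature.Barriers.RiemannHypothesis.jensenPoly_xiTaylorCoeff_splits_of_le_6330256`, and `4×` the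
range of `jensenPoly_xiTaylorCoeff_splits_allShifts_of_le_1582564`.
[cite: GriffinEtAl2022, Theorem 1.2] [cite: KimLee2021, Theorem 4 and Remark] [cite: OdlyzkoTeRiele1985, §4.2 p. 151] -/
theorem jensenPoly_xiTaylorCoeff_splits_allShifts_of_le_6330256 {d : ℕ} (hd : d ≤ 6330256)
    (n : ℕ) : (jensenPoly xiTaylorCoeff d n).Splits :=
  jensenPoly_xiTaylorCoeff_splits_allShifts_of_riemannHypothesisUpTo (T := 2516) (by norm_num)
    riemannHypothesisUpTo_2516 (by norm_num; exact_mod_cast hd) n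

/-- The certified all-shift range in GORZ's wording ("`J^{d,n}_γ` is hyperbolic for every `n ≥ 0`",
for all `d ≤ 6 330 256`; compiled evaluation — `d ≤ 10 201` in the kernel alone).
[cite: KimLee2021, Theorem 4 and Remark] -/
theorem jensenPoly_xiTaylorCoeff_splits_allShifts_upTo_6330256 :
    ∀ d n : ℕ, d ≤ 6330256 → (jensenPoly xiTaylorCoeff d n).Splits :=
  fun _ n hd => jensenPoly_xiTaylorCoeff_splits_allShifts_of_le_6330256 hd n

/-- **The printed all-shift range `d ≤ 9·10²⁴`, conditionally on the Platt–Trudgian verification**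
(Kim–Lee, Remark after Thm. 4: "the Riemann hypothesis has been verified for `|Im z| ≤ 3·10¹²` [PT].
Thus Theorems 3 and 4 imply that … `J(Ξ₀⁽ⁿ⁾; d)` is hyperbolic for `d ≤ 9·10²⁴` … and for every
`n`"; the journal version of GORTTW, Cor. 1.3: "if `d ≤ 9 × 10²⁴` and `n ≥ 0`, then `J^{d,n}(X)` is
hyperbolic"). From the named hypothesis
`riemannHypothesisUpTo_platt_trudgian = RiemannHypothesisUpTo 3 000 175 332 800` (Platt–Trudgian
2021, Thm. 1 — a named fact of the tree, not a theorem) every `J^{d,n}_γ` with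
`d ≤ 3 000 175 332 800² = 9 001 052 027 541 590 755 840 000 ≈ 9.001·10²⁴` splits over `ℝ`: the
all-shift companion of `Literature.Barriers.RiemannHypothesis.GORZ2019_chasse_of_platt_trudgian_numerical_rh`.
[cite: KimLee2021, Theorem 4 and Remark] [cite: GriffinEtAl2022, Corollary 1.3]
[cite: PlattTrudgianBLMS2021, Theorem 1] -/
theorem jensenPoly_xiTaylorCoeff_splits_allShifts_of_platt_trudgian
    (h : riemannHypothesisUpTo_platt_trudgian) {d : ℕ} (hd : d ≤ 9001052027541590755840000)
    (n : ℕ) : (jensenPoly xiTaylorCoeff d n).Splits :=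
  jensenPoly_xiTaylorCoeff_splits_allShifts_of_riemannHypothesisUpTo (T := 3000175332800)
    (by norm_num) h (by norm_num; exact_mod_cast hd) n

end Literature.NumberTheory.LFunctions

end
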